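import Summits.Langlands.Langlands.Theses.RamifiedCoefficientSeed
import Summits.Langlands.Langlands.Theorems.RamifiedCoefficientSeedAdjointSeedFromDuality

/-!
# Line `birth` for crux stmt-Langlands-16780 — state after lead cycle 1 (6/7 stubs landed)
`Summit.Langlands.Langlands.Theses.RamifiedCoefficientSeed.AdjointSeedFromDuality`

Stubs A–F of the lead's reshape are LANDED theorems (imported through the assembly file
`Summits/Langlands/Langlands/Theorems/RamifiedCoefficientSeedAdjointSeedFromDuality.lean`, p160602):
A `stub_residualDualReduction` (p159705), B `stub_symmetricSimilitudeForm` (p159578),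
C `stub_adSurjectiveOfSplitForm` (p159928), D `stub_twistedAdjointOfGO3` (p160275),
E `stub_oddOfConjugationTrace` (p159666), F `stub_seedOfExactOddLift` (p160018), and the composition is the
landed `Summit.Langlands.Langlands.Theorems.RamifiedCoefficientSeed.adjointSeedFromDuality_of_exactOddLift`.
The ONE open stub is G `stub_exactOddLift` — the lifting engine (odd, absolutely irreducible
`τ̄ : Γ_ℚ → GL₂(ℤ̄_p/𝔪)` with open kernel is a reduction of a continuous `ρ₀ : Γ_ℚ → GL₂(ℚ̄_p)`), which is
Khare–Wintenberger's "arises from a newform" clause (Invent. Math. 178 (2009), (I) §1, Thm. 1.2, Thm. 9.1 with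
Kisin's Hypothesis (H)) — a named, unproved fact: the crux is CLOSED MODULO it.  (Vendoring that clause as a
Literature fact bounced at relocation, p159648 `literature.conjecture`; the conditional 1-liner is attached to
the item as evidence `StubG-conditional.lean`; the fact-free `p ∤ |im τ̄|` branch cannot cover
`PSL₂(𝔽_{p^r})` images.)

Disproof used: Disproof.lean cycle 1 (cdisprove): all stubs audited true as typed; no stub kill.
-/

-- `Summit.Langlands.Langlands.…` repeats a namespace component by design (D-0017 nested layout).
set_option linter.dupNamespace false

namespace Summit.Langlands.Langlands.Cruxes.AdjointSeedFromDuality.Birth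

open scoped MatrixGroups
open Summit.Langlands.Langlands.Theses.RamifiedCoefficientSeed
open Literature.NumberTheory.GaloisRepresentations

/-! ## 1. The one open stub -/

/-- **STUB G — the lifting engine: odd absolutely irreducible residual `GL₂`-representations of
`Γ_ℚ` lift to characteristic zero.**  For `p ≥ 5` and `τ̄ : Γ_ℚ → GL₂(ℤ̄_p/𝔪)` with open kernel,
absolutely irreducible and odd at some complex conjugation, there is a continuous
`ρ₀ : Γ_ℚ → GL₂(ℚ̄_p)` of which `τ̄` is a reduction.  `p ∤ |im τ̄|`: Serre LRFG §15.5 Prop. 43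
(tree `prop43_lift_holds`, over `intermediateFieldIntegers p ℚ_p(ζ_{p^r−1})`); `p ∣ |im τ̄|`:
Khare–Wintenberger (named fact `khare_wintenberger` + Deligne's construction, or the printed
"arises from" clause of KW (I) §1/Thm 1.2/Thm 9.1).  Expected to close only CONDITIONALLY.
[cite: KhareWintenberger2009, §1, Thm. 1.2 and Thm. 9.1] [folklore] -/
theorem stub_exactOddLift (p : ℕ) [Fact p.Prime] (hp : 5 ≤ p)
    (τbar : Field.absoluteGaloisGroup ℚ →* GL (Fin 2) (padicAlgClResidueField p))
    (hτopen : IsOpen ((τbar.ker : Subgroup (Field.absoluteGaloisGroup ℚ)) :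
      Set (Field.absoluteGaloisGroup ℚ)))
    (hτirr : IsAbsIrreducible τbar)
    (hodd : ∃ (φ : ℚ →+* ℝ) (c : Field.absoluteGaloisGroup ℚ),
      IsComplexConjugation φ c ∧ Matrix.GeneralLinearGroup.det (τbar c) = -1) :
    ∃ ρ₀ : FramedGaloisRep ℚ (PadicAlgCl p) 2,
      ρ₀.IsReductionOf (RingHom.id (padicAlgClResidueField p)) τbar := by
  sorry

namespace _Goal

/-- The statement of `stub_exactOddLift`, as a named `Prop`. [folklore] -/
def stub_exactOddLift : Prop :=
  type_of% @Summit.Langlands.Langlands.Cruxes.AdjointSeedFromDuality.Birth.stub_exactOddLift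

end _Goal

/-! ## 2. The composition (kernel-checked, no `sorry`): the landed assembly applied to stub G -/

/-- **The crux from the one open stub.**  Stubs A–F are landed; the landed assembly
`RamifiedCoefficientSeed.adjointSeedFromDuality_of_exactOddLift` takes exactly the statement of stub G as
its hypothesis and concludes the route decl `AdjointSeedFromDuality` by name. [folklore] -/
theorem AdjointSeedFromDuality_of (hG : _Goal.stub_exactOddLift) : AdjointSeedFromDuality :=
  Summit.Langlands.Langlands.Theorems.RamifiedCoefficientSeed.adjointSeedFromDuality_of_exactOddLift hG

/-- By-name sanity check (an `example`, not a declaration): the open stub feeds the composition. -/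
example : AdjointSeedFromDuality := AdjointSeedFromDuality_of stub_exactOddLift

end Summit.Langlands.Langlands.Cruxes.AdjointSeedFromDuality.Birth
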